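import Summits.CriticalPhenomena.SAWScalingLimit.Theorems.SAWRenewalTightnessEventualTightShellCountOfCleanMultiShadow

/-!
# `EventualTight`, line `Sketch` (v5), rung `bulkShellTight_of_bulkCleanMultiShadowDecay`:
# confinement and the BULK clean multi-strand shadowing atom give per-shell traversal-count
# tightness on INTERIOR shells (`BulkShellTight`)

Crux item `stmt-CriticalPhenomena-1372` (`SAWRenewalTightness.EventualTight`), line `Sketch`,
registration v5 (lead c3).  The v4 atom S3′ `stub_cleanMultiShadowDecay` (all shells; crux-equivalent,
`Theorems.cleanMultiShadowDecay_iff_eventualTight`) is reshaped along the summit-safe split of the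
sibling crux `ShellCrossingBound` (`Theorems.ShellCrossingBound_of_subs`:
`ConfinementPositivity → BulkShellTight → ShellCrossingBound`) into

* S3″ `stub_bulkCleanMultiShadowDecay` — S3′ restricted to INTERIOR shells `D(x; r, R)`,
  `B̄(x, 2R) ⊆ Ω` (hypothesis 2 below), and
* E `stub_confinementPositivity` — restriction positivity for nested Dobrushin domains.

This file is the per-interior-shell form of the landed glue S2′
(`Theorems.stub_shellCountOfCleanMultiShadow`): **`Confinement → BulkCleanMultiShadowDecay →
BulkShellTight`**, where `BulkShellTight` is verbatim the second hypothesis of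
`Theorems.ShellCrossingBound_of_subs` (per-shell tightness of the traversal count on interior shells,
with its own eventual mesh threshold — so, unlike S2′, no coarse-mesh cutoff is needed).

Proof.  Fix an interior shell `D(y; η, R)` and `ε > 0`; the atom gives a resolution `η' > 0`, a
strand number `j` and a mesh threshold `δ₁`; confinement gives `L, δc`; the deterministic core of S2′,
`exists_cleanShadowingFamily_of_hasTraversals` in the compact disc `B̄(0, L)` (clean every traversal,
keep a co-oriented half, hyperspace pigeonhole in sub-family form), gives `k` such that `k` separate
traversals of `D(y; η, R)` by a curve in `B̄(0, L)` contain `j` clean, co-oriented, pairwise mutually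
`η'`-shadowing separate traversal strands OF THE SAME SHELL; hence for `δ ≤ min δ₁ δc` the event
`{k traversals}` is contained in the atom's event and has probability `≤ ε`.

No definitions; tree vocabulary only.  Source: M. Aizenman, A. Burchard, *Hölder regularity and
dimension bounds for random curves*, Duke Math. J. 99 (1999), §1.b; the coding-by-a-net pigeonhole
is standard. [folklore]
-/

noncomputable section

open MeasureTheory Filter Topology Set Metric
open scoped ENNReal NNReal unitInterval
open Literature.Probability.RandomPlanarGeometry Literature.Probability.LatticeModels

namespace Summit.CriticalPhenomena.SAWScalingLimit.Theorems

/-- **Rung `bulkShellTight_of_bulkCleanMultiShadowDecay` of the line `Sketch` (v5):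
`Confinement → BulkCleanMultiShadowDecay → BulkShellTight`, all three unfolded over tree vocabulary.**
If for small meshes every critical SAW polyline of `Ω_δ` from `a_δ` to `b_δ` lies in one compact disc
`B̄(0, L)` (confinement, landed as `Theorems.stub_confinement`), and for every INTERIOR genuine shell
`D(x; r, R)` (`B̄(x, 2R) ⊆ Ω`) and `θ > 0` some resolution `η > 0`, strand number `j` and mesh
threshold `δ₁ > 0` make `j` clean, co-oriented, pairwise mutually `η`-shadowing separate traversal
strands `θ`-improbable for `δ ∈ (0, δ₁]` (the bulk atom S3″), then for every interior genuine shell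
and `ε > 0` some threshold `j` and mesh bound `δ₁ > 0` make `j` separate traversals `ε`-improbable
for `δ ∈ (0, δ₁]` — the statement `BulkShellTight` consumed by `Theorems.ShellCrossingBound_of_subs`.
[folklore] -/
theorem bulkShellTight_of_bulkCleanMultiShadowDecay :
    (∀ (D : DobrushinDomain) (a b : ℝ → Site 2), SAW.IsEndpointApprox D a b →
      ∃ (L δ₀ : ℝ), 0 < δ₀ ∧ ∀ δ ∈ Set.Ioc (0 : ℝ) δ₀,
        ∀ γ : SAW.DomainSAW D.carrier δ (a δ) (b δ),
          (⟨γ.walk.toCurve (meshPoint δ)⟩ : Curve ℂ).range ⊆ Metric.closedBall (0 : ℂ) L) →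
    (∀ (D : DobrushinDomain) (a b : ℝ → Site 2), SAW.IsEndpointApprox D a b →
      ∀ (x : ℂ) (r R : ℝ), 0 < r → r < R → Metric.closedBall x (2 * R) ⊆ D.carrier →
        ∀ θ : ℝ, 0 < θ →
        ∃ η : ℝ, 0 < η ∧ ∃ (j : ℕ) (δ₁ : ℝ), 0 < δ₁ ∧ ∀ δ ∈ Set.Ioc (0 : ℝ) δ₁,
          SAW.law D.carrier δ (a δ) (b δ)
            {γ | ∃ s t : Fin j → unitInterval,
              (∀ i, (⟨γ.walk.toCurve (meshPoint δ)⟩ : Curve ℂ).IsTraversal x r R (s i) (t i)) ∧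
              ((∀ i, dist ((⟨γ.walk.toCurve (meshPoint δ)⟩ : Curve ℂ) (s i)) x ≤ r) ∨
                (∀ i, R ≤ dist ((⟨γ.walk.toCurve (meshPoint δ)⟩ : Curve ℂ) (s i)) x)) ∧
              (∀ (i : Fin j) (u : unitInterval), s i < u → u < t i →
                r < dist ((⟨γ.walk.toCurve (meshPoint δ)⟩ : Curve ℂ) u) x ∧
                  dist ((⟨γ.walk.toCurve (meshPoint δ)⟩ : Curve ℂ) u) x < R) ∧
              (∀ ⦃i i' : Fin j⦄, i < i' → t i < s i') ∧
              ∀ (i i' : Fin j) (u : unitInterval), s i ≤ u → u ≤ t i →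
                ∃ v : unitInterval, s i' ≤ v ∧ v ≤ t i' ∧
                  dist ((⟨γ.walk.toCurve (meshPoint δ)⟩ : Curve ℂ) u)
                    ((⟨γ.walk.toCurve (meshPoint δ)⟩ : Curve ℂ) v) ≤ η}
            ≤ ENNReal.ofReal θ) →
    ∀ (D : DobrushinDomain) (a b : ℝ → Site 2), SAW.IsEndpointApprox D a b →
      ∀ (y : ℂ) (η R : ℝ), 0 < η → η < R → Metric.closedBall y (2 * R) ⊆ D.carrier →
        ∀ ε : ℝ, 0 < ε → ∃ (j : ℕ) (δ₁ : ℝ), 0 < δ₁ ∧ ∀ δ ∈ Set.Ioc (0 : ℝ) δ₁,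
          SAW.law D.carrier δ (a δ) (b δ)
            {γ | (⟨γ.walk.toCurve (meshPoint δ)⟩ : Curve ℂ).HasTraversals j y η R} ≤
            ENNReal.ofReal ε := by
  intro hConf hAtom D a b hab y η R hη hηR hball ε hε
  obtain ⟨L, δc, hδc, hconf⟩ := hConf D a b hab
  obtain ⟨η', hη', j, δ₁, hδ₁, hbound⟩ := hAtom D a b hab y η R hη hηR hball ε hε
  -- the deterministic threshold in the confining disc (clean, co-orient, pigeonhole — same shell)
  obtain ⟨k₁, hk₁⟩ :=
    exists_cleanShadowingFamily_of_hasTraversals (isCompact_closedBall (0 : ℂ) L) y η R hη' j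
  refine ⟨k₁, min δ₁ δc, lt_min hδ₁ hδc, fun δ hδ => ?_⟩
  refine le_trans (measure_mono fun γ hγ => ?_) (hbound δ ⟨hδ.1, hδ.2.trans (min_le_left _ _)⟩)
  exact hk₁ _ (hconf δ ⟨hδ.1, hδ.2.trans (min_le_right _ _)⟩ γ) hγ

end Summit.CriticalPhenomena.SAWScalingLimit.Theorems

end
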